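import Summits.CriticalPhenomena.Ising3DConformalLimit.Theses.SubPtolemyInterlacing

/-!
# `SubPtolemyFloor` (item stmt-CriticalPhenomena-15703): the collinear CEILING of the sub-Ptolemy method

Negative / structural knowledge about the crux
`Summit.CriticalPhenomena.Ising3DConformalLimit.Theses.SubPtolemyInterlacing.SubPtolemyFloor` (route
SubPtolemyInterlacing, r3) and its sibling `InterlacingEventualBalanced` (stmt-CriticalPhenomena-18014);
THEOREM-ONLY, no new definitions. Harvested from the forward seat `fwd-rung-CriticalPhenomena-02`
(G1 next-rung over the proved floor `Theorems.interlacingForcesU4_proof`), whose one S-direction rung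
`ThresholdRung a₀` ("relax the floor threshold `log₂(1+√2)` to some `a₀ > log₂(1+√2)`") this file CAPS.

For a pure-power two-point function `d ↦ κ d^{-x}` (`x = 2Δ`) on a line and the GAUSSIAN (Wick) four-point
function, the limit sub-Ptolemy inequality at the interlaced collinear quadruple with consecutive gaps
`a, b, c > 0` — pairing distance-products `p = ac` ((12)(34)), `q = (a+b+c)b` ((14)(23)) and the crossing one
`r = (a+b)(b+c) = p + q` (Ptolemy's EQUALITY on a line) — reads `2 ≤ (t^{-x} - 1)((1-t)^{-x} - 1)` with the
cross-ratio `t = p/r ∈ (0,1)` (`wick_spc_iff_defectProduct`; this is `2 ≤ (u-1)(t-1)` of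
`Cruxes/Interlacing/Disproof.lean` §G′). The balanced point is `t = 1/2`, where the defect product is
`(2^x - 1)²` (`defectProduct_half`; sign test of `ThresholdTight.lean`).

* `sq_le_defectProduct` (MAIN) — for `x ≥ 1` and every `t ∈ (0,1)`: `(2^x - 1)² ≤ (t^{-x} - 1)((1-t)^{-x} - 1)`,
  equality at `t = 1/2`. Proof: `w ↦ log((1 + e^w)^x - 1)` is convex on `ℝ` (its derivative is
  `x(m-1)m^{x-1}/(m^x-1)` at `m = 1 + e^w`, monotone in `m` by the secant inequality for the convex power
  `m ↦ m^{1-x}`), and `(m₁-1)(m₂-1) = 1` for `m₁ = 1/t`, `m₂ = 1/(1-t)`.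
* `two_le_defectProduct_of_threshold_le`, `wick_spc_of_threshold_le` — consequently, once
  `2Δ = x ≥ log₂(1+√2)` the Gaussian family obeys the limit sub-Ptolemy inequality at EVERY collinear
  interlaced configuration, not only at the balanced one: the balanced cross-ratio IS the extremal one
  (the "extremality claim" left as prose in `Cruxes/Interlacing/Disproof.lean` §G′, now a theorem for all
  `x ≥ 1`).
* `wickPow_allGaps_of_threshold_le`, `wickPow_allGaps_iff_threshold_le` — lattice-indexed form: the Wick law
  on the axial power law `n ↦ n^{-s}` satisfies the interlacing inequality at ALL gaps `(a,b,c) ≥ 1` IFF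
  `log₂(1+√2) ≤ s` (the `←` half is new; the `→` half is the balanced instance `(2,1,3)`, cf.
  `Cruxes/Interlacing/Disproof.lean` §C1 `not_wickSPC_pow_of_lt_threshold`, whose exact converse this is).

READING (ladder ceiling, BC9 of the forward discipline). Inside the collinear sub-Ptolemy method the floor
threshold `a < log₂(1+√2)` of r3 cannot be relaxed: for `2Δ ∈ [log₂(1+√2), 3/2]` the Gaussian family with
`S₂ = κ d^{-2Δ}` satisfies everything the method sees in the limit (limit-SPC at all collinear interlaced
configurations, Lebowitz `U₄ ≤ 0`, translation/scale covariance, non-degeneracy), so no choice or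
combination of collinear configurations forces `U₄ ≠ 0` above the threshold; a lift needs a
Gaussian-excluding four-point input (cf. item stmt-CriticalPhenomena-5505 `WindowForcesU4`). Together
with `ThresholdTight.balancedTest_nonneg_of_threshold_le` (balanced point only) this makes the route's
kill criterion "η(3) ≥ 0.2716 closes the route" exact for the whole collinear family.
-/

noncomputable section

namespace Summit.CriticalPhenomena.Ising3DConformalLimit.SubPtolemyFloorNegative

open Real Set

/-! ### §1 Calculus: convexity of `w ↦ log((1 + e^w)^x - 1)` for `x ≥ 1` -/

/-- `m ↦ m^s` is convex on `(0, ∞)` for `s ≤ 0` (weighted AM–GM twice). [folklore] -/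
theorem ceiling_convexOn_rpow_of_nonpos {s : ℝ} (hs : s ≤ 0) :
    ConvexOn ℝ (Ioi (0 : ℝ)) (fun m : ℝ => m ^ s) := by
  refine ⟨convex_Ioi 0, ?_⟩
  intro m hm m' hm' μ ν hμ hν hμν
  simp only [smul_eq_mul]
  have hm0 : (0 : ℝ) < m := hm
  have hm0' : (0 : ℝ) < m' := hm'
  have hag : m ^ μ * m' ^ ν ≤ μ * m + ν * m' :=
    Real.geom_mean_le_arith_mean2_weighted hμ hν hm0.le hm0'.le hμν
  have hgpos : 0 < m ^ μ * m' ^ ν := mul_pos (Real.rpow_pos_of_pos hm0 _) (Real.rpow_pos_of_pos hm0' _)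
  have h1 : (μ * m + ν * m') ^ s ≤ (m ^ μ * m' ^ ν) ^ s :=
    Real.rpow_le_rpow_of_nonpos hgpos hag hs
  have h2 : (m ^ μ * m' ^ ν) ^ s = (m ^ s) ^ μ * (m' ^ s) ^ ν := by
    rw [Real.mul_rpow (Real.rpow_nonneg hm0.le _) (Real.rpow_nonneg hm0'.le _),
      ← Real.rpow_mul hm0.le, ← Real.rpow_mul hm0'.le, ← Real.rpow_mul hm0.le,
      ← Real.rpow_mul hm0'.le, mul_comm μ s, mul_comm ν s]
  have h3 : (m ^ s) ^ μ * (m' ^ s) ^ ν ≤ μ * m ^ s + ν * m' ^ s :=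
    Real.geom_mean_le_arith_mean2_weighted hμ hν (Real.rpow_nonneg hm0.le _)
      (Real.rpow_nonneg hm0'.le _) hμν
  calc (μ * m + ν * m') ^ s ≤ (m ^ μ * m' ^ ν) ^ s := h1
    _ = (m ^ s) ^ μ * (m' ^ s) ^ ν := h2
    _ ≤ μ * m ^ s + ν * m' ^ s := h3

/-- Secant slopes of the convex function `m ↦ m^{1-x}` (`x ≥ 1`) from the base point `1` increase.
[folklore] -/
theorem ceiling_secant_rpow_mono {x : ℝ} (hx : 1 ≤ x) {m m' : ℝ} (hm : 1 < m) (hmm' : m ≤ m') :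
    (m ^ (1 - x) - 1) / (m - 1) ≤ (m' ^ (1 - x) - 1) / (m' - 1) := by
  have hconv := ceiling_convexOn_rpow_of_nonpos (s := 1 - x) (by linarith)
  have h := hconv.secant_mono (a := 1) (x := m) (y := m') (mem_Ioi.2 one_pos)
    (mem_Ioi.2 (by linarith)) (mem_Ioi.2 (by linarith)) (by linarith : m ≠ 1)
    (by linarith : m' ≠ 1) hmm'
  simpa [Real.one_rpow] using h

/-- `1 < m^x` for `m > 1`, `x ≥ 1`. [folklore] -/
theorem ceiling_one_lt_rpow {x m : ℝ} (hx : 1 ≤ x) (hm : 1 < m) : 1 < m ^ x :=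
  Real.one_lt_rpow hm (by linarith)

/-- The derivative profile rewritten through the secant slope:
`x(m-1)m^{x-1}/(m^x-1) = x / (1 + (1 - m^{1-x})/(m-1))` for `m > 1`, `x ≥ 1`. [folklore] -/
theorem ceiling_profile_eq {x m : ℝ} (hx : 1 ≤ x) (hm : 1 < m) :
    x * (m - 1) * m ^ (x - 1) / (m ^ x - 1) = x / (1 + (1 - m ^ (1 - x)) / (m - 1)) := by
  have hm0 : 0 < m := by linarith
  have hm1 : m - 1 ≠ 0 := by linarith
  have hpow : m ^ x = m ^ (x - 1) * m := by
    rw [Real.rpow_sub_one hm0.ne']; field_simp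
  have hinv : m ^ (1 - x) = (m ^ (x - 1))⁻¹ := by
    rw [show (1 - x) = -(x - 1) by ring, Real.rpow_neg hm0.le]
  have hpos : 0 < m ^ (x - 1) := Real.rpow_pos_of_pos hm0 _
  have hden : m ^ x - 1 ≠ 0 := ne_of_gt (by linarith [ceiling_one_lt_rpow hx hm])
  rw [hinv]
  have hden2 : 1 + (1 - (m ^ (x - 1))⁻¹) / (m - 1) ≠ 0 := by
    have : (m ^ (x - 1))⁻¹ ≤ 1 := by
      rw [inv_le_one_iff₀]; right
      exact Real.one_le_rpow hm.le (by linarith)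
    have h2 : 0 ≤ (1 - (m ^ (x - 1))⁻¹) / (m - 1) := div_nonneg (by linarith) (by linarith)
    linarith
  rw [hpow]
  field_simp
  ring

/-- The derivative profile `m ↦ x(m-1)m^{x-1}/(m^x-1)` is monotone on `(1, ∞)` for `x ≥ 1`. [folklore] -/
theorem ceiling_profile_mono {x : ℝ} (hx : 1 ≤ x) {m m' : ℝ} (hm : 1 < m) (hmm' : m ≤ m') :
    x * (m - 1) * m ^ (x - 1) / (m ^ x - 1) ≤ x * (m' - 1) * m' ^ (x - 1) / (m' ^ x - 1) := by
  have hm' : 1 < m' := lt_of_lt_of_le hm hmm'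
  rw [ceiling_profile_eq hx hm, ceiling_profile_eq hx hm']
  have hφ : (1 - m' ^ (1 - x)) / (m' - 1) ≤ (1 - m ^ (1 - x)) / (m - 1) := by
    have h := ceiling_secant_rpow_mono hx hm hmm'
    have e1 : (1 - m ^ (1 - x)) / (m - 1) = -((m ^ (1 - x) - 1) / (m - 1)) := by ring
    have e2 : (1 - m' ^ (1 - x)) / (m' - 1) = -((m' ^ (1 - x) - 1) / (m' - 1)) := by ring
    rw [e1, e2]; linarith
  have hφpos : 0 ≤ (1 - m' ^ (1 - x)) / (m' - 1) := by
    apply div_nonneg _ (by linarith)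
    have : m' ^ (1 - x) ≤ 1 := Real.rpow_le_one_of_one_le_of_nonpos hm'.le (by linarith)
    linarith
  have hxpos : 0 ≤ x := by linarith
  exact div_le_div_of_nonneg_left hxpos (by linarith) (by linarith)

/-- `1 < 1 + e^w`. [folklore] -/
theorem ceiling_base_gt_one (w : ℝ) : 1 < 1 + Real.exp w := by linarith [Real.exp_pos w]

/-- `0 < (1 + e^w)^x - 1` for `x ≥ 1`. [folklore] -/
theorem ceiling_inner_pos {x : ℝ} (hx : 1 ≤ x) (w : ℝ) : 0 < (1 + Real.exp w) ^ x - 1 := by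
  linarith [ceiling_one_lt_rpow hx (ceiling_base_gt_one w)]

/-- Derivative of `w ↦ log((1 + e^w)^x - 1)`: the profile at `m = 1 + e^w`. [folklore] -/
theorem ceiling_hasDerivAt_log {x : ℝ} (hx : 1 ≤ x) (w : ℝ) :
    HasDerivAt (fun w : ℝ => Real.log ((1 + Real.exp w) ^ x - 1))
      (x * (1 + Real.exp w - 1) * (1 + Real.exp w) ^ (x - 1) / ((1 + Real.exp w) ^ x - 1)) w := by
  have h1 : HasDerivAt (fun w => 1 + Real.exp w) (Real.exp w) w :=
    (Real.hasDerivAt_exp w).const_add 1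
  have h2 : HasDerivAt (fun w => (1 + Real.exp w) ^ x)
      (Real.exp w * x * (1 + Real.exp w) ^ (x - 1)) w :=
    h1.rpow_const (Or.inr hx)
  have h3 : HasDerivAt (fun w => (1 + Real.exp w) ^ x - 1)
      (Real.exp w * x * (1 + Real.exp w) ^ (x - 1)) w := h2.sub_const 1
  have h4 := h3.log (ceiling_inner_pos hx w).ne'
  convert h4 using 1
  ring

/-- `w ↦ log((1 + e^w)^x - 1)` is convex on `ℝ` for `x ≥ 1`. [folklore] -/
theorem ceiling_convexOn_log {x : ℝ} (hx : 1 ≤ x) :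
    ConvexOn ℝ univ (fun w : ℝ => Real.log ((1 + Real.exp w) ^ x - 1)) := by
  refine MonotoneOn.convexOn_of_deriv convex_univ ?_ ?_ ?_
  · exact (continuous_iff_continuousAt.2
      fun w => (ceiling_hasDerivAt_log hx w).continuousAt).continuousOn
  · exact fun w _ => (ceiling_hasDerivAt_log hx w).differentiableAt.differentiableWithinAt
  · have hd : deriv (fun w : ℝ => Real.log ((1 + Real.exp w) ^ x - 1)) =
        fun w => x * (1 + Real.exp w - 1) * (1 + Real.exp w) ^ (x - 1) / ((1 + Real.exp w) ^ x - 1) :=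
      funext fun w => (ceiling_hasDerivAt_log hx w).deriv
    rw [hd]
    intro w _ w' _ hww'
    exact ceiling_profile_mono hx (ceiling_base_gt_one w) (by simpa using Real.exp_le_exp.2 hww')

/-- Core two-variable form: `(m₁ - 1)(m₂ - 1) = 1 ⇒ (2^x - 1)² ≤ (m₁^x - 1)(m₂^x - 1)` for `x ≥ 1`
(midpoint convexity of `w ↦ log((1 + e^w)^x - 1)` at `±log(m₁ - 1)`). [folklore] -/
theorem ceiling_core {x : ℝ} (hx : 1 ≤ x) {m₁ m₂ : ℝ} (h1 : 1 < m₁) (h2 : 1 < m₂)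
    (h : (m₁ - 1) * (m₂ - 1) = 1) :
    (2 ^ x - 1) ^ 2 ≤ (m₁ ^ x - 1) * (m₂ ^ x - 1) := by
  set w := Real.log (m₁ - 1) with hw
  have hm1 : 1 + Real.exp w = m₁ := by rw [hw, Real.exp_log (by linarith)]; ring
  have hm2 : 1 + Real.exp (-w) = m₂ := by
    rw [Real.exp_neg, hw, Real.exp_log (by linarith)]
    have hne : m₁ - 1 ≠ 0 := by linarith
    field_simp
    linarith [h]
  have hconv := ceiling_convexOn_log hx
  have hmid := hconv.2 (mem_univ w) (mem_univ (-w)) (by norm_num : (0:ℝ) ≤ 1/2)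
    (by norm_num : (0:ℝ) ≤ 1/2) (by norm_num : (1/2 : ℝ) + 1/2 = 1)
  have h0 : (1/2 : ℝ) • w + (1/2 : ℝ) • (-w) = 0 := by simp only [smul_eq_mul]; ring
  rw [h0] at hmid
  simp only [smul_eq_mul, Real.exp_zero, hm1, hm2] at hmid
  have h2x : (1 + 1 : ℝ) ^ x = 2 ^ x := by norm_num
  rw [h2x] at hmid
  -- hmid : log (2^x - 1) ≤ 1/2 * log (m₁^x - 1) + 1/2 * log (m₂^x - 1)
  have hA : 0 < m₁ ^ x - 1 := by linarith [ceiling_one_lt_rpow hx h1]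
  have hB : 0 < m₂ ^ x - 1 := by linarith [ceiling_one_lt_rpow hx h2]
  have hC : 0 < (2:ℝ) ^ x - 1 := by
    linarith [ceiling_one_lt_rpow hx (by norm_num : (1:ℝ) < 2)]
  have hlog : Real.log ((2 ^ x - 1) ^ 2) ≤ Real.log ((m₁ ^ x - 1) * (m₂ ^ x - 1)) := by
    rw [Real.log_pow, Real.log_mul hA.ne' hB.ne']
    push_cast
    linarith
  exact (Real.log_le_log_iff (pow_pos hC 2) (mul_pos hA hB)).1 hlog

/-! ### §2 MAIN: the defect product is minimal at the balanced cross-ratio -/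

/-- **Ceiling lemma (MAIN).** For `x ≥ 1` and `t ∈ (0,1)`:
`(2^x - 1)² ≤ (t^{-x} - 1)((1-t)^{-x} - 1)`, with equality at the balanced point `t = 1/2`
(`defectProduct_half`). [folklore] -/
theorem sq_le_defectProduct {x t : ℝ} (hx : 1 ≤ x) (ht0 : 0 < t) (ht1 : t < 1) :
    (2 ^ x - 1) ^ 2 ≤ (t ^ (-x) - 1) * ((1 - t) ^ (-x) - 1) := by
  have e1 : t ^ (-x) = t⁻¹ ^ x := by rw [Real.rpow_neg ht0.le, Real.inv_rpow ht0.le]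
  have e2 : (1 - t) ^ (-x) = (1 - t)⁻¹ ^ x := by
    rw [Real.rpow_neg (by linarith), Real.inv_rpow (by linarith)]
  rw [e1, e2]
  refine ceiling_core hx (one_lt_inv_iff₀.2 ⟨ht0, ht1⟩)
    (one_lt_inv_iff₀.2 ⟨by linarith, by linarith⟩) ?_
  have ht' : t ≠ 0 := ht0.ne'
  have h1t : 1 - t ≠ 0 := by linarith
  field_simp
  ring

/-- At the balanced point the defect product is `(2^x - 1)²`. [folklore] -/
theorem defectProduct_half (x : ℝ) :
    ((1 / 2 : ℝ) ^ (-x) - 1) * ((1 - 1 / 2) ^ (-x) - 1) = (2 ^ x - 1) ^ 2 := by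
  have h : (1 / 2 : ℝ) ^ (-x) = 2 ^ x := by
    rw [Real.rpow_neg (by norm_num), one_div, Real.inv_rpow (by norm_num), inv_inv]
  have h' : (1 - 1 / 2 : ℝ) = 1 / 2 := by norm_num
  rw [h', h]
  ring

/-- **Ceiling, threshold form.** If `2^x ≥ 1 + √2` then `2 ≤ (t^{-x} - 1)((1-t)^{-x} - 1)` for every
`t ∈ (0,1)` (note `1 + √2 > 2` forces `x > 1`). [folklore] -/
theorem two_le_defectProduct_of_rpow_threshold {x t : ℝ} (hthr : 1 + Real.sqrt 2 ≤ (2:ℝ) ^ x)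
    (ht0 : 0 < t) (ht1 : t < 1) : 2 ≤ (t ^ (-x) - 1) * ((1 - t) ^ (-x) - 1) := by
  have hs : Real.sqrt 2 ^ 2 = 2 := Real.sq_sqrt (by norm_num)
  have hs1 : (1:ℝ) < Real.sqrt 2 := by
    rw [show (1:ℝ) = Real.sqrt 1 by simp]
    exact Real.sqrt_lt_sqrt (by norm_num) (by norm_num)
  have hx1 : 1 ≤ x := by
    by_contra hlt
    have : (2:ℝ) ^ x < 2 ^ (1:ℝ) := Real.rpow_lt_rpow_of_exponent_lt (by norm_num) (by linarith)
    rw [Real.rpow_one] at this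
    linarith
  have h := sq_le_defectProduct hx1 ht0 ht1
  have h2 : (2:ℝ) ≤ (2 ^ x - 1) ^ 2 := by nlinarith [Real.sqrt_nonneg 2]
  linarith

/-- **Ceiling, `log₂` form.** If `log₂(1+√2) ≤ x` (e.g. `x = 2Δ` with `Δ` outside the window of r3)
then `2 ≤ (t^{-x} - 1)((1-t)^{-x} - 1)` for every `t ∈ (0,1)`. [folklore] -/
theorem two_le_defectProduct_of_threshold_le {x t : ℝ} (hx : Real.logb 2 (1 + Real.sqrt 2) ≤ x)
    (ht0 : 0 < t) (ht1 : t < 1) : 2 ≤ (t ^ (-x) - 1) * ((1 - t) ^ (-x) - 1) := by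
  have hpos : (0:ℝ) < 1 + Real.sqrt 2 := by positivity
  have hthr : 1 + Real.sqrt 2 ≤ (2:ℝ) ^ x := by
    have := Real.rpow_le_rpow_of_exponent_le (by norm_num : (1:ℝ) ≤ 2) hx
    rwa [Real.rpow_logb (by norm_num) (by norm_num) hpos] at this
  exact two_le_defectProduct_of_rpow_threshold hthr ht0 ht1

/-- **Sharpness at the balanced point** (the floor's mechanism, for contrast; all real `x`):
the balanced defect product `(2^x - 1)²` is `< 2` iff `x < log₂(1+√2)`. [folklore] -/
theorem defectProduct_half_lt_two_iff (x : ℝ) :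
    ((1 / 2 : ℝ) ^ (-x) - 1) * ((1 - 1 / 2) ^ (-x) - 1) < 2 ↔ x < Real.logb 2 (1 + Real.sqrt 2) := by
  rw [defectProduct_half]
  have hs : Real.sqrt 2 ^ 2 = 2 := Real.sq_sqrt (by norm_num)
  have hs0 : 0 ≤ Real.sqrt 2 := Real.sqrt_nonneg 2
  have hpos : (0:ℝ) < 1 + Real.sqrt 2 := by positivity
  have h2x : 0 < (2:ℝ) ^ x := Real.rpow_pos_of_pos (by norm_num) x
  rw [Real.lt_logb_iff_rpow_lt one_lt_two hpos]
  constructor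
  · intro h
    by_contra hle
    rw [not_lt] at hle
    nlinarith [hle, hs, hs0]
  · intro h
    have hs1 : (1:ℝ) < Real.sqrt 2 := by
      rw [show (1:ℝ) = Real.sqrt 1 by simp]
      exact Real.sqrt_lt_sqrt (by norm_num) (by norm_num)
    have h3 : 0 < (1 + Real.sqrt 2 - (2:ℝ) ^ x) * ((2:ℝ) ^ x - 1 + Real.sqrt 2) :=
      mul_pos (by linarith) (by linarith)
    nlinarith [h3, hs]

/-! ### §3 Dictionary: the Wick four-point function at a collinear interlaced configuration -/

/-- **Dictionary.** For pairing distance-products `p, q > 0`, `r = p + q` (Ptolemy's EQUALITY on a line)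
and pure-power pairing weights `p^{-x}, q^{-x}, r^{-x}`, the Wick four-point function
`W = p^{-x} + q^{-x} + r^{-x}` satisfies the sub-Ptolemy inequality `W · r^{-x} ≤ p^{-x} q^{-x}` iff
`2 ≤ (t^{-x} - 1)((1-t)^{-x} - 1)` with the cross-ratio `t = p/(p+q)`. [folklore] -/
theorem wick_spc_iff_defectProduct {x p q : ℝ} (hp : 0 < p) (hq : 0 < q) :
    (p ^ (-x) + q ^ (-x) + (p + q) ^ (-x)) * (p + q) ^ (-x) ≤ p ^ (-x) * q ^ (-x) ↔
      2 ≤ ((p / (p + q)) ^ (-x) - 1) * ((1 - p / (p + q)) ^ (-x) - 1) := by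
  have hr : 0 < p + q := by linarith
  have e1 : (p / (p + q)) ^ (-x) = p ^ (-x) / (p + q) ^ (-x) := Real.div_rpow hp.le hr.le _
  have e2 : (1 - p / (p + q)) = q / (p + q) := by field_simp; ring
  have e3 : (q / (p + q)) ^ (-x) = q ^ (-x) / (p + q) ^ (-x) := Real.div_rpow hq.le hr.le _
  rw [e2, e1, e3]
  have hR : 0 < (p + q) ^ (-x) := Real.rpow_pos_of_pos hr _
  have hP : 0 < p ^ (-x) := Real.rpow_pos_of_pos hp _
  have hQ : 0 < q ^ (-x) := Real.rpow_pos_of_pos hq _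
  rw [div_sub_one hR.ne', div_sub_one hR.ne', div_mul_div_comm, le_div_iff₀ (mul_pos hR hR)]
  constructor <;> intro h <;> nlinarith [h, hR, hP, hQ]

/-- **Ceiling, Wick form.** Above the threshold (`log₂(1+√2) ≤ x`), the Wick four-point function obeys
the limit sub-Ptolemy inequality at EVERY collinear interlaced configuration `(p, q)`. [folklore] -/
theorem wick_spc_of_threshold_le {x p q : ℝ} (hx : Real.logb 2 (1 + Real.sqrt 2) ≤ x) (hp : 0 < p)
    (hq : 0 < q) :
    (p ^ (-x) + q ^ (-x) + (p + q) ^ (-x)) * (p + q) ^ (-x) ≤ p ^ (-x) * q ^ (-x) :=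
  (wick_spc_iff_defectProduct hp hq).2 (two_le_defectProduct_of_threshold_le hx
    (div_pos hp (by linarith)) ((div_lt_one (by linarith)).2 (by linarith)))

/-! ### §4 Lattice corollary: the Gaussian caricature of `Interlacing` at ALL gaps iff the threshold -/

/-- **All gaps above the threshold.** For `log₂(1+√2) ≤ s` the Wick law on the axial power law
`n ↦ n^{-s}` satisfies the interlacing (sub-Ptolemy) inequality at EVERY axis quadruple
`(0, a, a+b, a+b+c)`, `a, b, c ≥ 1` — verbatim `WickSPC (powG s)` of `Cruxes/Interlacing/Disproof.lean`
§C1, unfolded. [folklore] -/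
theorem wickPow_allGaps_of_threshold_le {s : ℝ} (hs : Real.logb 2 (1 + Real.sqrt 2) ≤ s)
    (a b c : ℕ) (ha : 1 ≤ a) (hb : 1 ≤ b) (hc : 1 ≤ c) :
    ((a : ℝ) ^ (-s) * (c : ℝ) ^ (-s) + ((a + b : ℕ) : ℝ) ^ (-s) * ((b + c : ℕ) : ℝ) ^ (-s) +
        ((a + b + c : ℕ) : ℝ) ^ (-s) * (b : ℝ) ^ (-s)) *
      (((a + b : ℕ) : ℝ) ^ (-s) * ((b + c : ℕ) : ℝ) ^ (-s)) ≤
    (a : ℝ) ^ (-s) * (c : ℝ) ^ (-s) * (((a + b + c : ℕ) : ℝ) ^ (-s) * (b : ℝ) ^ (-s)) := by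
  have hA : (0:ℝ) < a := by exact_mod_cast ha
  have hB : (0:ℝ) < b := by exact_mod_cast hb
  have hC : (0:ℝ) < c := by exact_mod_cast hc
  have hABC : (0:ℝ) < (a:ℝ) + b + c := by linarith
  have h := wick_spc_of_threshold_le (x := s) hs (mul_pos hA hC) (mul_pos hABC hB)
  have e1 : (a:ℝ) * c + ((a:ℝ) + b + c) * b = ((a:ℝ) + b) * ((b:ℝ) + c) := by ring
  rw [e1, Real.mul_rpow hA.le hC.le, Real.mul_rpow hABC.le hB.le,
    Real.mul_rpow (by linarith) (by linarith)] at h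
  push_cast
  convert h using 2
  ring

/-- **Sharp characterisation.** The Wick law on `n ↦ n^{-s}` satisfies the interlacing inequality at all
gaps IFF `log₂(1+√2) ≤ s`: `→` is the balanced instance `(a,b,c) = (2,1,3)` (cross-ratio `1/2`,
`defectProduct_half_lt_two_iff`), `←` is the ceiling. So the balanced quadruples carry ALL the
anti-Gaussian content of the collinear family, and no collinear configuration lowers the two-point
threshold of route SubPtolemyInterlacing. [folklore] -/
theorem wickPow_allGaps_iff_threshold_le (s : ℝ) :
    (∀ a b c : ℕ, 1 ≤ a → 1 ≤ b → 1 ≤ c →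
      ((a : ℝ) ^ (-s) * (c : ℝ) ^ (-s) + ((a + b : ℕ) : ℝ) ^ (-s) * ((b + c : ℕ) : ℝ) ^ (-s) +
          ((a + b + c : ℕ) : ℝ) ^ (-s) * (b : ℝ) ^ (-s)) *
        (((a + b : ℕ) : ℝ) ^ (-s) * ((b + c : ℕ) : ℝ) ^ (-s)) ≤
      (a : ℝ) ^ (-s) * (c : ℝ) ^ (-s) * (((a + b + c : ℕ) : ℝ) ^ (-s) * (b : ℝ) ^ (-s))) ↔
    Real.logb 2 (1 + Real.sqrt 2) ≤ s := by
  refine ⟨fun h => ?_, fun hs a b c ha hb hc => wickPow_allGaps_of_threshold_le hs a b c ha hb hc⟩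
  have h213 := h 2 1 3 (by norm_num) (by norm_num) (by norm_num)
  -- the balanced instance in `(p, q)` form: `p = 2·3 = 6`, `q = 6·1 = 6`, `p + q = 3·4 = 12`
  have h6 : (6:ℝ) ^ (-s) = (2:ℝ) ^ (-s) * (3:ℝ) ^ (-s) := by
    rw [show (6:ℝ) = 2 * 3 by norm_num, Real.mul_rpow (by norm_num) (by norm_num)]
  have h12 : (12:ℝ) ^ (-s) = (3:ℝ) ^ (-s) * (4:ℝ) ^ (-s) := by
    rw [show (12:ℝ) = 3 * 4 by norm_num, Real.mul_rpow (by norm_num) (by norm_num)]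
  have hpq : ((6:ℝ) ^ (-s) + (6:ℝ) ^ (-s) + (6 + 6 : ℝ) ^ (-s)) * (6 + 6 : ℝ) ^ (-s) ≤
      (6:ℝ) ^ (-s) * (6:ℝ) ^ (-s) := by
    rw [show (6 + 6 : ℝ) = 12 by norm_num, h6, h12]
    push_cast at h213
    norm_num at h213
    rw [h6] at h213
    linarith [h213]
  have h2 := (wick_spc_iff_defectProduct (x := s) (by norm_num : (0:ℝ) < 6)
    (by norm_num : (0:ℝ) < 6)).1 hpq
  rw [show (6:ℝ) / (6 + 6) = 1 / 2 by norm_num] at h2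
  by_contra hlt
  rw [not_le] at hlt
  have := (defectProduct_half_lt_two_iff s).2 hlt
  linarith

end Summit.CriticalPhenomena.Ising3DConformalLimit.SubPtolemyFloorNegative

end
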